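import Summits.Ventures.YMGap.RobustBall.HeatBathConcentration
import Summits.Ventures.YMGap.RobustBall.HeatBathPoincareBall
import HarnessLib

/-!
# Robust ball (Y2) — EXPONENTIAL CONCENTRATION OF EVERY LINK-LIPSCHITZ OBSERVABLE, UNIFORMLY ON THE TORUS BALL AND IN THE VOLUME

HONEST FRAMING: venture file of the cell `pub-ymgap` (QuantumFields programme), track ROBUST-BALL, seat rb-p2 (g14); the BALL-UNIFORM companion of the
Wilson concentration cells of `HeatBathSweepCells.lean` (g13): the abstract Gromov–Milman ∕ Aida–Stroock door `HeatBathConcentration.measureReal_deviation_ge_le_of_heatBathPoincare`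
fed with the ball-uniform heat-bath Poincaré inequality `HeatBathPoincareBall.su2_heatBathPoincare_onBall(_oneEighth)`.  LATTICE statements at STRONG COUPLING for
the torus measures `μ_{β,W,L} = Z⁻¹ e^{−β S_W − W} ∏ dU_e` of the MEMBERS `W` of the cell's torus ball (per-link loads of a `LoadWitness`: oscillation `a(e) ≤ ε₀`,
self-Lipschitz `ℓ_s(e) ≤ ε₁`, COLUMN cross-Lipschitz `∑_{e≠y} ℓ(e,y) ≤ ε₂`), `SU(2)`, `d = 4`, on `(ℤ/L)⁴`, `L ≥ 2`; the member's OWN measure appears; constants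
independent of `L` and of the member; nothing about `β → ∞`, the continuum or Clay.
* ★★★ `su2_measureReal_deviation_ge_le_onBall` ∕ `…_le_le_onBall` — quarter modulus, loads `(ε₀, ε₁, ε₂)`, `c := (9β_W/2)e^{ε₀}(1 + 2√2 ε₁) + √2 ε₂ < 1`,
  every `0 ≤ β_W ≤ 2/3`: for every member, every bounded measurable `f` with link oscillations `|f(U) − f(U[ℓ ↦ g])| ≤ δ_ℓ` (`∑ δ_ℓ² > 0`) and every `r`,
  `μ_{β,W,L}{±(f − E f) ≥ r} ≤ e^{2/3} exp(−r / √(2 (2(1 − c))⁻¹ ∑_ℓ δ_ℓ²))`;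
* ★★ `su2_measureReal_deviation_ge_le_onBall_oneEighth` ∕ `…_le_le_onBall_oneEighth` — the sprint loads `(1/100, 1/500, 1/500)`, EVERY `0 ≤ β_W ≤ 1/8`, EVERY member,
  EVERY torus: `μ_{β,W,L}{±(f − E f) ≥ r} ≤ e^{2/3} exp(−r / √((5/2) ∑_ℓ δ_ℓ²))` (e.g. the plaquette average over `|Λ_p|` plaquettes, `∑ δ² ≤ 96/|Λ_p|`:
  deviations `≥ r` have probability `≤ e^{2/3} e^{−r |Λ_p|^{1/2}/(4√15)}`) — a McDiarmid-type inequality of Poincaré (exponential) strength holding with ONE rate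
  on the whole ball.
0 sorry, 0 definitions.  References: M. Gromov, V. Milman, Amer. J. Math. 105 (1983) 843; S. Aida, D. Stroock, Math. Res. Lett. 1 (1994) 75; M. Ledoux, The
Concentration of Measure Phenomenon (AMS 2001) §3.1; L. Wu, Ann. Probab. 34 (2006) 1960.  Everything here is proved. [folklore]
-/

noncomputable section

open MeasureTheory Function Real Finset ProbabilityTheory
open Summit.QuantumFields.YangMills.Theorems.StrongPinningPoincare
open Literature.Probability.LatticeModels Literature.Probability.LatticeModels.DobrushinMetric
open Literature.MathematicalPhysics.QuantumLattice hiding torusNorm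
open Literature.MathematicalPhysics.QuantumFieldTheory hiding ZdEdge
open Literature.MathematicalPhysics.QuantumFieldTheory.Balaban1983to89.StrongCouplingTorusWindow
open Summit.Ventures.YMGap.RobustBall.HeatBathConcentration

namespace Summit.Ventures.YMGap.RobustBall.HeatBathConcentration

variable {L : ℕ} [NeZero L]

/-- ★★★ **BALL-UNIFORM EXPONENTIAL CONCENTRATION, upper tail** (`SU(2)`, `d = 4`, quarter modulus; loads `a ≤ ε₀`, `ℓ_s ≤ ε₁`, column `∑_{e≠y} ℓ(e,y) ≤ ε₂`;
`c := (9β_W/2)e^{ε₀}(1 + 2√2 ε₁) + √2 ε₂ < 1`, `0 ≤ β_W ≤ 2/3`): for every member `W` of the torus ball, every torus of side `≥ 2`, every bounded measurable `f`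
with `|f(U) − f(U[ℓ ↦ g])| ≤ δ_ℓ` (`∑_ℓ δ_ℓ² > 0`) and every `r`, `μ_{β,W,L}{f − E f ≥ r} ≤ e^{2/3} exp(−r / √(2(2(1 − c))⁻¹ ∑_ℓ δ_ℓ²))`. [folklore] -/
theorem su2_measureReal_deviation_ge_le_onBall {βW ε₀ ε₁ ε₂ c : ℝ} (h0 : 0 ≤ βW) (h23 : βW ≤ 2 / 3) (hL : 1 < L) {W : Perturbation 4 L 2}
    (w : LoadWitness W) (ha : ∀ e, w.oscLoad 0 e ≤ ε₀) (hs : ∀ e, w.selfLipLoad 0 e ≤ ε₁)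
    (hcol : ∀ y, ∑ e ∈ univ.erase y, w.crossLip 0 e y ≤ ε₂)
    (hc : 9 * βW / 2 * Real.exp ε₀ * (1 + 2 * Real.sqrt 2 * ε₁) + Real.sqrt 2 * ε₂ ≤ c) (hc1 : c < 1)
    (f : GaugeConfig 4 L (SUN 2) → ℝ) (hf : Measurable f) {M : ℝ} (hM : ∀ U, |f U| ≤ M)
    (δ : Edge 4 L → ℝ) (hδ : ∀ ℓ U g, |f U - f (update U ℓ g)| ≤ δ ℓ) (hD : 0 < ∑ ℓ, δ ℓ ^ 2) (r : ℝ) :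
    (W.perturbedMeasure (fundamentalRep (Fin 2)) (βW / 2)).real
        {U | r ≤ f U - ∫ U', f U' ∂(W.perturbedMeasure (fundamentalRep (Fin 2)) (βW / 2))} ≤
      Real.exp (2 / 3) * Real.exp (-r / Real.sqrt (2 * (2 * (1 - c))⁻¹ * ∑ ℓ, δ ℓ ^ 2)) := by
  classical
  set V : GaugeConfig 4 L (SUN 2) → ℝ := fun U => torusLogWeight (wilsonPlaqWeight 2 (βW / 2)) U - W.total U with hV
  have hVm : Measurable V := measurable_perturbedTorusEnergy W (βW / 2)
  obtain ⟨B₁, hVb⟩ := exists_abs_perturbedTorusEnergy_le W (βW / 2)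
  have hμ : W.perturbedMeasure (fundamentalRep (Fin 2)) (βW / 2) = (Measure.pi fun _ : Edge 4 L => haarProbability (SUN 2)).tilted V :=
    perturbedMeasure_eq_tilted W (βW / 2)
  have hP : ∀ F : GaugeConfig 4 L (SUN 2) → ℝ, Measurable F → (∃ M : ℝ, ∀ x, |F x| ≤ M) →
      variance F ((Measure.pi fun _ : Edge 4 L => haarProbability (SUN 2)).tilted V) ≤
        (2 * (1 - c))⁻¹ * ∑ i, ∫ x, ∫ e, (F x - F (update x i e)) ^ 2
          ∂((haarProbability (SUN 2)).tilted fun e => V (update x i e)) ∂((Measure.pi fun _ : Edge 4 L => haarProbability (SUN 2)).tilted V) := by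
    intro F hF hFb
    rw [← hμ]
    exact HeatBathPoincareBall.su2_heatBathPoincare_onBall h0 h23 hL w ha hs hcol hc hc1 F hF hFb
  have hA : (0 : ℝ) < (2 * (1 - c))⁻¹ := inv_pos.2 (by linarith)
  have key := measureReal_deviation_ge_le_of_heatBathPoincare (haarProbability (SUN 2)) hVm hVb hP hA hf hM δ hδ hD r
  rw [← hμ] at key
  exact key

/-- ★★★ **BALL-UNIFORM EXPONENTIAL CONCENTRATION, lower tail**: `μ_{β,W,L}{f − E f ≤ −r} ≤ e^{2/3} exp(−r / √(2(2(1 − c))⁻¹ ∑_ℓ δ_ℓ²))`. [folklore] -/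
theorem su2_measureReal_deviation_le_le_onBall {βW ε₀ ε₁ ε₂ c : ℝ} (h0 : 0 ≤ βW) (h23 : βW ≤ 2 / 3) (hL : 1 < L) {W : Perturbation 4 L 2}
    (w : LoadWitness W) (ha : ∀ e, w.oscLoad 0 e ≤ ε₀) (hs : ∀ e, w.selfLipLoad 0 e ≤ ε₁)
    (hcol : ∀ y, ∑ e ∈ univ.erase y, w.crossLip 0 e y ≤ ε₂)
    (hc : 9 * βW / 2 * Real.exp ε₀ * (1 + 2 * Real.sqrt 2 * ε₁) + Real.sqrt 2 * ε₂ ≤ c) (hc1 : c < 1)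
    (f : GaugeConfig 4 L (SUN 2) → ℝ) (hf : Measurable f) {M : ℝ} (hM : ∀ U, |f U| ≤ M)
    (δ : Edge 4 L → ℝ) (hδ : ∀ ℓ U g, |f U - f (update U ℓ g)| ≤ δ ℓ) (hD : 0 < ∑ ℓ, δ ℓ ^ 2) (r : ℝ) :
    (W.perturbedMeasure (fundamentalRep (Fin 2)) (βW / 2)).real
        {U | f U - ∫ U', f U' ∂(W.perturbedMeasure (fundamentalRep (Fin 2)) (βW / 2)) ≤ -r} ≤
      Real.exp (2 / 3) * Real.exp (-r / Real.sqrt (2 * (2 * (1 - c))⁻¹ * ∑ ℓ, δ ℓ ^ 2)) := by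
  classical
  set V : GaugeConfig 4 L (SUN 2) → ℝ := fun U => torusLogWeight (wilsonPlaqWeight 2 (βW / 2)) U - W.total U with hV
  have hVm : Measurable V := measurable_perturbedTorusEnergy W (βW / 2)
  obtain ⟨B₁, hVb⟩ := exists_abs_perturbedTorusEnergy_le W (βW / 2)
  have hμ : W.perturbedMeasure (fundamentalRep (Fin 2)) (βW / 2) = (Measure.pi fun _ : Edge 4 L => haarProbability (SUN 2)).tilted V :=
    perturbedMeasure_eq_tilted W (βW / 2)
  have hP : ∀ F : GaugeConfig 4 L (SUN 2) → ℝ, Measurable F → (∃ M : ℝ, ∀ x, |F x| ≤ M) →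
      variance F ((Measure.pi fun _ : Edge 4 L => haarProbability (SUN 2)).tilted V) ≤
        (2 * (1 - c))⁻¹ * ∑ i, ∫ x, ∫ e, (F x - F (update x i e)) ^ 2
          ∂((haarProbability (SUN 2)).tilted fun e => V (update x i e)) ∂((Measure.pi fun _ : Edge 4 L => haarProbability (SUN 2)).tilted V) := by
    intro F hF hFb
    rw [← hμ]
    exact HeatBathPoincareBall.su2_heatBathPoincare_onBall h0 h23 hL w ha hs hcol hc hc1 F hF hFb
  have hA : (0 : ℝ) < (2 * (1 - c))⁻¹ := inv_pos.2 (by linarith)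
  have key := measureReal_deviation_le_le_of_heatBathPoincare (haarProbability (SUN 2)) hVm hVb hP hA hf hM δ hδ hD r
  rw [← hμ] at key
  exact key

/-- ★★ **THE SPRINT BALL: loads `(1/100, 1/500, 1/500)`, EVERY `0 ≤ β_W ≤ 1/8`, EVERY member, EVERY torus — upper tail**
`μ_{β,W,L}{f − E f ≥ r} ≤ e^{2/3} exp(−r / √((5/2) ∑_ℓ δ_ℓ²))`. [folklore] -/
theorem su2_measureReal_deviation_ge_le_onBall_oneEighth {βW : ℝ} (h0 : 0 ≤ βW) (h8 : βW ≤ 1 / 8) (hL : 1 < L) {W : Perturbation 4 L 2}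
    (w : LoadWitness W) (ha : ∀ e, w.oscLoad 0 e ≤ 1 / 100) (hs : ∀ e, w.selfLipLoad 0 e ≤ 1 / 500)
    (hcol : ∀ y, ∑ e ∈ univ.erase y, w.crossLip 0 e y ≤ 1 / 500)
    (f : GaugeConfig 4 L (SUN 2) → ℝ) (hf : Measurable f) {M : ℝ} (hM : ∀ U, |f U| ≤ M)
    (δ : Edge 4 L → ℝ) (hδ : ∀ ℓ U g, |f U - f (update U ℓ g)| ≤ δ ℓ) (hD : 0 < ∑ ℓ, δ ℓ ^ 2) (r : ℝ) :
    (W.perturbedMeasure (fundamentalRep (Fin 2)) (βW / 2)).real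
        {U | r ≤ f U - ∫ U', f U' ∂(W.perturbedMeasure (fundamentalRep (Fin 2)) (βW / 2))} ≤
      Real.exp (2 / 3) * Real.exp (-r / Real.sqrt (5 / 2 * ∑ ℓ, δ ℓ ^ 2)) := by
  classical
  set V : GaugeConfig 4 L (SUN 2) → ℝ := fun U => torusLogWeight (wilsonPlaqWeight 2 (βW / 2)) U - W.total U with hV
  have hVm : Measurable V := measurable_perturbedTorusEnergy W (βW / 2)
  obtain ⟨B₁, hVb⟩ := exists_abs_perturbedTorusEnergy_le W (βW / 2)
  have hμ : W.perturbedMeasure (fundamentalRep (Fin 2)) (βW / 2) = (Measure.pi fun _ : Edge 4 L => haarProbability (SUN 2)).tilted V :=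
    perturbedMeasure_eq_tilted W (βW / 2)
  have hP : ∀ F : GaugeConfig 4 L (SUN 2) → ℝ, Measurable F → (∃ M : ℝ, ∀ x, |F x| ≤ M) →
      variance F ((Measure.pi fun _ : Edge 4 L => haarProbability (SUN 2)).tilted V) ≤
        (5 / 4 : ℝ) * ∑ i, ∫ x, ∫ e, (F x - F (update x i e)) ^ 2
          ∂((haarProbability (SUN 2)).tilted fun e => V (update x i e)) ∂((Measure.pi fun _ : Edge 4 L => haarProbability (SUN 2)).tilted V) := by
    intro F hF hFb
    rw [← hμ]
    exact HeatBathPoincareBall.su2_heatBathPoincare_onBall_oneEighth h0 h8 hL w ha hs hcol F hF hFb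
  have key := measureReal_deviation_ge_le_of_heatBathPoincare (haarProbability (SUN 2)) hVm hVb hP (by norm_num) hf hM δ hδ hD r
  have e : (2 * (5 / 4 : ℝ)) = 5 / 2 := by norm_num
  rw [← hμ, e] at key
  exact key

/-- ★★ **THE SPRINT BALL — lower tail**: `μ_{β,W,L}{f − E f ≤ −r} ≤ e^{2/3} exp(−r / √((5/2) ∑_ℓ δ_ℓ²))`, every `0 ≤ β_W ≤ 1/8`, every member, every torus. [folklore] -/
theorem su2_measureReal_deviation_le_le_onBall_oneEighth {βW : ℝ} (h0 : 0 ≤ βW) (h8 : βW ≤ 1 / 8) (hL : 1 < L) {W : Perturbation 4 L 2}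
    (w : LoadWitness W) (ha : ∀ e, w.oscLoad 0 e ≤ 1 / 100) (hs : ∀ e, w.selfLipLoad 0 e ≤ 1 / 500)
    (hcol : ∀ y, ∑ e ∈ univ.erase y, w.crossLip 0 e y ≤ 1 / 500)
    (f : GaugeConfig 4 L (SUN 2) → ℝ) (hf : Measurable f) {M : ℝ} (hM : ∀ U, |f U| ≤ M)
    (δ : Edge 4 L → ℝ) (hδ : ∀ ℓ U g, |f U - f (update U ℓ g)| ≤ δ ℓ) (hD : 0 < ∑ ℓ, δ ℓ ^ 2) (r : ℝ) :
    (W.perturbedMeasure (fundamentalRep (Fin 2)) (βW / 2)).real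
        {U | f U - ∫ U', f U' ∂(W.perturbedMeasure (fundamentalRep (Fin 2)) (βW / 2)) ≤ -r} ≤
      Real.exp (2 / 3) * Real.exp (-r / Real.sqrt (5 / 2 * ∑ ℓ, δ ℓ ^ 2)) := by
  classical
  set V : GaugeConfig 4 L (SUN 2) → ℝ := fun U => torusLogWeight (wilsonPlaqWeight 2 (βW / 2)) U - W.total U with hV
  have hVm : Measurable V := measurable_perturbedTorusEnergy W (βW / 2)
  obtain ⟨B₁, hVb⟩ := exists_abs_perturbedTorusEnergy_le W (βW / 2)
  have hμ : W.perturbedMeasure (fundamentalRep (Fin 2)) (βW / 2) = (Measure.pi fun _ : Edge 4 L => haarProbability (SUN 2)).tilted V :=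
    perturbedMeasure_eq_tilted W (βW / 2)
  have hP : ∀ F : GaugeConfig 4 L (SUN 2) → ℝ, Measurable F → (∃ M : ℝ, ∀ x, |F x| ≤ M) →
      variance F ((Measure.pi fun _ : Edge 4 L => haarProbability (SUN 2)).tilted V) ≤
        (5 / 4 : ℝ) * ∑ i, ∫ x, ∫ e, (F x - F (update x i e)) ^ 2
          ∂((haarProbability (SUN 2)).tilted fun e => V (update x i e)) ∂((Measure.pi fun _ : Edge 4 L => haarProbability (SUN 2)).tilted V) := by
    intro F hF hFb
    rw [← hμ]
    exact HeatBathPoincareBall.su2_heatBathPoincare_onBall_oneEighth h0 h8 hL w ha hs hcol F hF hFb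
  have key := measureReal_deviation_le_le_of_heatBathPoincare (haarProbability (SUN 2)) hVm hVb hP (by norm_num) hf hM δ hδ hD r
  have e : (2 * (5 / 4 : ℝ)) = 5 / 2 := by norm_num
  rw [← hμ, e] at key
  exact key

end Summit.Ventures.YMGap.RobustBall.HeatBathConcentration

end
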